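import Mathlib
import HarnessLib
import Summits.ValiantsHypothesis.ValiantsHypothesis.Theorems.LacunarySymmetroidMatrixDescartesOsculationLawCuspCubic
import Summits.ValiantsHypothesis.ValiantsHypothesis.Theorems.LacunarySymmetroidMatrixDescartesOsculationLawThreeKThreeZeroPencil
import Summits.ValiantsHypothesis.ValiantsHypothesis.Theorems.LacunarySymmetroidMatrixDescartesOsculationCensusRankOneLower

/-!
# ValiantsHypothesis / LacunarySymmetroid — crux `MatrixDescartes` (stmt-ValiantsHypothesis-18050, V1),
# line «osculation-law» (`Cruxes/MatrixDescartes/Lines/osculation_law.lean`), rung O3 «extremal-support families from the census»: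
# the RANK-THREE TOP certificate, splitting `(3, 0)` — finiteness + count from two exact checks, and the LOWER side from sign windows

Roster R2664 (b) / R2685 (O3 = val-sym-engine-7; this file engine-7 g4).  Companion of ✓ `…OsculationCensusRankOneCert` (`(1,s)`), ✓ `…RankTwoCert`
(`(2,0)`) and ✓ `…RankTwoSCert` (`(2,s)`); the O3 table (OSC-TABLE-g3) has located-exact counts 2 (F4) and 4 (F6) at the top splitting `(3,0)` of the
`m = 3` extremisers with no kernel counterpart so far.

CONTENT (every `K`; the line's `osculationSet d S` with `blockProj`, `insertionPoly`, `euler`, `logHessian` UNFOLDED verbatim).  For a pencil `G(t)` on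
`Fin 3 ⊕ Fin 0` the insertion polynomial is the MONIC CUBIC `Φ(t,b) = b³ + σ₁ b² + σ₂ b + σ₃`, `σ₁ = tr G`, `σ₂` = principal `2 × 2` minors, `σ₃ = det G`
(✓ `OsculationThreeK.insertionPoly_three_zero`); on the curve the bordered log-Hessian vanishes iff `R₂(t) b² + R₁(t) b + R₀(t) = 0` with the tree's
weight polynomials `R₂, R₁, R₀` of `σ₁, σ₂, σ₃` (✓ `OsculationCuspCubic.hess_reduce_poly3`); a second Euclid step gives `L₁(t) b + L₀(t) = 0`
(`L₁ = σ₂R₂² − R₀R₂ − σ₁R₁R₂ + R₁²`, `L₀ = σ₃R₂² − σ₁R₀R₂ + R₀R₁`; ✓ `linear_step3`) and then `N(t) = 0`, `N = R₂L₀² − R₁L₀L₁ + R₀L₁²` (✓ `resultant_step3`).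
* `osc_rankThreeTop_finite_card_le` (UPPER): if `N ≢ 0` and `L₁ ≢ 0` the osculation set is FINITE with `ncard ≤ 3·(N_N + N_L)` for degree bounds
  `deg N ≤ N_N`, `deg L₁ ≤ N_L` (abscissae are roots of `N` or of `L₁`; each fibre is the root set of a MONIC cubic — no vertical ray can occur).
* `osc_rankThreeTop_card_ge` (LOWER): `k` pairwise separated windows `[l, u] ⊂ (0, ∞)` with `N(l)·N(u) ≤ 0` and `L₁·L₀ < 0`, `R₂ ≠ 0` on `[l, u]` exhibit `k`
  distinct osculation points `(t, −L₀(t)/L₁(t))` (`R₂b²+R₁b+R₀ = N/L₁² = 0`, `Φ = 0` by ✓ `euclid_step3` and `R₂ ≠ 0`, `H = 0` by the reduction), so `k ≤ ncard`.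

HONEST FRAMING.  Calibration tooling for a line stub (`m = 3` is covered by `rungThree` / `rungAll`); the LAW `stub_osculationLaw`, the crux `MatrixDescartes`,
Conjecture B and `VP ≠ VNP` are OPEN / NOT proved; no summit statement is proved by this file.  No definitions, no named facts; Mathlib + the tree files
`…OsculationLawCuspCubic` (`eval_Phi3`, `eval_logHessian_Phi3`, `hess_reduce_poly3`, `euclid_step3`, `linear_step3`, `resultant_step3`),
`…ThreeKThreeZeroPencil` (`insertionPoly_three_zero`), `…OsculationCensusRankOneLower` (`exists_root_of_mul_nonpos`).
-/

-- `Summit.ValiantsHypothesis.ValiantsHypothesis.…` is the tree's mandated single-conjunct layout (Sub = Summit).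
set_option linter.dupNamespace false
-- the three reduction polynomials make the statements long left-nested sums: raise the elaborator's recursion budget.
set_option maxRecDepth 100000

noncomputable section

namespace Summit.ValiantsHypothesis.ValiantsHypothesis.Theorems.LacunarySymmetroidMatrixDescartes

open Polynomial Matrix Finset
open scoped BigOperators

namespace OsculationCensus

/-- A real cubic with leading coefficient `1` is not the zero polynomial. [folklore] -/
theorem monicCubic_ne_zero (s₁ s₂ s₃ : ℝ) : (C (1 : ℝ) * X ^ 3 + C s₁ * X ^ 2 + C s₂ * X + C s₃ : ℝ[X]) ≠ 0 := by
  intro h0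
  have h3 := congr_arg (fun q : ℝ[X] => q.coeff 3) h0
  simp only [coeff_add, coeff_C_mul, coeff_X_pow, coeff_X, coeff_C, coeff_zero] at h3
  norm_num at h3

-- the statement carries the three reduction polynomials and the osculation set three times.
set_option maxHeartbeats 1600000 in
/-- **Rank-three TOP certificate, splitting `(3, 0)` (UPPER side).**  See the module docstring. [folklore] -/
theorem osc_rankThreeTop_finite_card_le {K : ℕ} (d : Fin K → ℕ) (S : Fin K → Matrix (Fin 3 ⊕ Fin 0) (Fin 3 ⊕ Fin 0) ℝ)
    (σ₁ σ₂ σ₃ R₂ R₁ R₀ L₁ L₀ : ℝ[X])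
    (h1 : (∑ l, (X : ℝ[X]) ^ d l • (S l).map Polynomial.C) (Sum.inl 0) (Sum.inl 0) + (∑ l, (X : ℝ[X]) ^ d l • (S l).map Polynomial.C) (Sum.inl 1) (Sum.inl 1) + (∑ l, (X : ℝ[X]) ^ d l • (S l).map Polynomial.C) (Sum.inl 2) (Sum.inl 2) = σ₁)
    (h2 : (∑ l, (X : ℝ[X]) ^ d l • (S l).map Polynomial.C) (Sum.inl 0) (Sum.inl 0) * (∑ l, (X : ℝ[X]) ^ d l • (S l).map Polynomial.C) (Sum.inl 1) (Sum.inl 1) - (∑ l, (X : ℝ[X]) ^ d l • (S l).map Polynomial.C) (Sum.inl 0) (Sum.inl 1) * (∑ l, (X : ℝ[X]) ^ d l • (S l).map Polynomial.C) (Sum.inl 1) (Sum.inl 0) + (∑ l, (X : ℝ[X]) ^ d l • (S l).map Polynomial.C) (Sum.inl 0) (Sum.inl 0) * (∑ l, (X : ℝ[X]) ^ d l • (S l).map Polynomial.C) (Sum.inl 2) (Sum.inl 2) - (∑ l, (X : ℝ[X]) ^ d l • (S l).map Polynomial.C) (Sum.inl 0) (Sum.inl 2) * (∑ l, (X : ℝ[X])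 ^ d l • (S l).map Polynomial.C) (Sum.inl 2) (Sum.inl 0) + (∑ l, (X : ℝ[X]) ^ d l • (S l).map Polynomial.C) (Sum.inl 1) (Sum.inl 1) * (∑ l, (X : ℝ[X]) ^ d l • (S l).map Polynomial.C) (Sum.inl 2) (Sum.inl 2) - (∑ l, (X : ℝ[X]) ^ d l • (S l).map Polynomial.C) (Sum.inl 1) (Sum.inl 2) * (∑ l, (X : ℝ[X]) ^ d l • (S l).map Polynomial.C) (Sum.inl 2) (Sum.inl 1) = σ₂)
    (h3 : (∑ l, (X : ℝ[X]) ^ d l • (S l).map Polynomial.C) (Sum.inl 0) (Sum.inl 0) * (∑ l, (X : ℝ[X]) ^ d l • (S l).map Polynomial.C) (Sum.inl 1) (Sum.inl 1) * (∑ l, (X : ℝ[X]) ^ d l • (S l).map Polynomial.C) (Sum.inl 2) (Sum.inl 2) - (∑ l, (X : ℝ[X]) ^ d l • (S l).map Polynomial.C) (Sum.inl 0) (Sum.inl 0) * (∑ l, (X : ℝ[X]) ^ d l • (S l).map Polynomial.C) (Sum.inl 1) (Sum.inl 2) * (∑ l, (X : ℝ[X]) ^ d l • (S l).map Polynomial.C)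 (Sum.inl 2) (Sum.inl 1) - (∑ l, (X : ℝ[X]) ^ d l • (S l).map Polynomial.C) (Sum.inl 0) (Sum.inl 1) * (∑ l, (X : ℝ[X]) ^ d l • (S l).map Polynomial.C) (Sum.inl 1) (Sum.inl 0) * (∑ l, (X : ℝ[X]) ^ d l • (S l).map Polynomial.C) (Sum.inl 2) (Sum.inl 2) + (∑ l, (X : ℝ[X]) ^ d l • (S l).map Polynomial.C) (Sum.inl 0) (Sum.inl 1) * (∑ l, (X : ℝ[X]) ^ d l • (S l).map Polynomial.C) (Sum.inl 1) (Sum.inl 2) * (∑ l, (X : ℝ[X]) ^ d l • (S l).map Polynomial.C) (Sum.inl 2) (Sum.inl 0) + (∑ l, (X : ℝ[X]) ^ d l • (S l).map Polynomial.C) (Sum.inl 0) (Sum.inl 2) * (∑ l, (X : ℝ[X]) ^ d l • (S l).map Polynomial.C) (Sum.inl 1) (Sum.inl 0) * (∑ l, (X : ℝ[X]) ^ d l • (S l).map Polynomial.C) (Sum.inl 2) (Sum.inl 1) - (∑ l, (X : ℝ[X]) ^ d l • (S l).map Polynomial.C) (Sum.inl 0) (Sum.inl 2) * (∑ l, (X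 : ℝ[X]) ^ d l • (S l).map Polynomial.C) (Sum.inl 1) (Sum.inl 1) * (∑ l, (X : ℝ[X]) ^ d l • (S l).map Polynomial.C) (Sum.inl 2) (Sum.inl 0) = σ₃)
    (hR2 : R₂ = σ₁ ^ 6 * (X * derivative (X * derivative σ₁)) - σ₁ ^ 5 * (X * derivative σ₁) ^ 2 - σ₁ ^ 5 * (X * derivative (X * derivative σ₂)) - 7 * σ₁ ^ 4 * σ₂ * (X * derivative (X * derivative σ₁))
          + 4 * σ₁ ^ 4 * (X * derivative σ₁) * (X * derivative σ₂) + σ₁ ^ 4 * (X * derivative (X * derivative σ₃)) + 3 * σ₁ ^ 3 * σ₂ * (X * derivative σ₁) ^ 2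
          + 6 * σ₁ ^ 3 * σ₂ * (X * derivative (X * derivative σ₂)) + 8 * σ₁ ^ 3 * σ₃ * (X * derivative (X * derivative σ₁)) - 6 * σ₁ ^ 3 * (X * derivative σ₁) * (X * derivative σ₃)
          - 3 * σ₁ ^ 3 * (X * derivative σ₂) ^ 2 + 13 * σ₁ ^ 2 * σ₂ ^ 2 * (X * derivative (X * derivative σ₁)) - 12 * σ₁ ^ 2 * σ₂ * (X * derivative σ₁) * (X * derivative σ₂)
          - 5 * σ₁ ^ 2 * σ₂ * (X * derivative (X * derivative σ₃)) + σ₁ ^ 2 * σ₃ * (X * derivative σ₁) ^ 2 - 7 * σ₁ ^ 2 * σ₃ * (X * derivative (X * derivative σ₂))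
          + 8 * σ₁ ^ 2 * (X * derivative σ₂) * (X * derivative σ₃) - σ₁ * σ₂ ^ 2 * (X * derivative σ₁) ^ 2 - 8 * σ₁ * σ₂ ^ 2 * (X * derivative (X * derivative σ₂))
          - 22 * σ₁ * σ₂ * σ₃ * (X * derivative (X * derivative σ₁)) + 14 * σ₁ * σ₂ * (X * derivative σ₁) * (X * derivative σ₃) + 7 * σ₁ * σ₂ * (X * derivative σ₂) ^ 2
          + 4 * σ₁ * σ₃ * (X * derivative σ₁) * (X * derivative σ₂) + 6 * σ₁ * σ₃ * (X * derivative (X * derivative σ₃)) - 5 * σ₁ * (X * derivative σ₃) ^ 2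
          - 4 * σ₂ ^ 3 * (X * derivative (X * derivative σ₁)) + 4 * σ₂ ^ 2 * (X * derivative σ₁) * (X * derivative σ₂) + 4 * σ₂ ^ 2 * (X * derivative (X * derivative σ₃))
          - 3 * σ₂ * σ₃ * (X * derivative σ₁) ^ 2 + 12 * σ₂ * σ₃ * (X * derivative (X * derivative σ₂)) - 12 * σ₂ * (X * derivative σ₂) * (X * derivative σ₃)
          + 9 * σ₃ ^ 2 * (X * derivative (X * derivative σ₁)) - 6 * σ₃ * (X * derivative σ₁) * (X * derivative σ₃) - 3 * σ₃ * (X * derivative σ₂) ^ 2)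
    (hR1 : R₁ = σ₁ ^ 5 * σ₂ * (X * derivative (X * derivative σ₁)) - σ₁ ^ 4 * σ₂ * (X * derivative σ₁) ^ 2 - σ₁ ^ 4 * σ₂ * (X * derivative (X * derivative σ₂)) - σ₁ ^ 4 * σ₃ * (X * derivative (X * derivative σ₁))
          - 6 * σ₁ ^ 3 * σ₂ ^ 2 * (X * derivative (X * derivative σ₁)) + 4 * σ₁ ^ 3 * σ₂ * (X * derivative σ₁) * (X * derivative σ₂) + σ₁ ^ 3 * σ₂ * (X * derivative (X * derivative σ₃))
          + σ₁ ^ 3 * σ₃ * (X * derivative σ₁) ^ 2 + σ₁ ^ 3 * σ₃ * (X * derivative (X * derivative σ₂)) + 2 * σ₁ ^ 2 * σ₂ ^ 2 * (X * derivative σ₁) ^ 2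
          + 5 * σ₁ ^ 2 * σ₂ ^ 2 * (X * derivative (X * derivative σ₂)) + 12 * σ₁ ^ 2 * σ₂ * σ₃ * (X * derivative (X * derivative σ₁)) - 6 * σ₁ ^ 2 * σ₂ * (X * derivative σ₁) * (X * derivative σ₃)
          - 3 * σ₁ ^ 2 * σ₂ * (X * derivative σ₂) ^ 2 - 4 * σ₁ ^ 2 * σ₃ * (X * derivative σ₁) * (X * derivative σ₂) - σ₁ ^ 2 * σ₃ * (X * derivative (X * derivative σ₃))
          + 8 * σ₁ * σ₂ ^ 3 * (X * derivative (X * derivative σ₁)) - 8 * σ₁ * σ₂ ^ 2 * (X * derivative σ₁) * (X * derivative σ₂) - 4 * σ₁ * σ₂ ^ 2 * (X * derivative (X * derivative σ₃))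
          + σ₁ * σ₂ * σ₃ * (X * derivative σ₁) ^ 2 - 10 * σ₁ * σ₂ * σ₃ * (X * derivative (X * derivative σ₂)) + 8 * σ₁ * σ₂ * (X * derivative σ₂) * (X * derivative σ₃)
          - 6 * σ₁ * σ₃ ^ 2 * (X * derivative (X * derivative σ₁)) + 6 * σ₁ * σ₃ * (X * derivative σ₁) * (X * derivative σ₃) + 3 * σ₁ * σ₃ * (X * derivative σ₂) ^ 2
          - 4 * σ₂ ^ 3 * (X * derivative (X * derivative σ₂)) - 16 * σ₂ ^ 2 * σ₃ * (X * derivative (X * derivative σ₁)) + 8 * σ₂ ^ 2 * (X * derivative σ₁) * (X * derivative σ₃)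
          + 4 * σ₂ ^ 2 * (X * derivative σ₂) ^ 2 + 4 * σ₂ * σ₃ * (X * derivative σ₁) * (X * derivative σ₂) + 12 * σ₂ * σ₃ * (X * derivative (X * derivative σ₃))
          - 8 * σ₂ * (X * derivative σ₃) ^ 2 - 3 * σ₃ ^ 2 * (X * derivative σ₁) ^ 2 + 9 * σ₃ ^ 2 * (X * derivative (X * derivative σ₂)) - 12 * σ₃ * (X * derivative σ₂) * (X * derivative σ₃))
    (hR0 : R₀ = σ₁ ^ 5 * σ₃ * (X * derivative (X * derivative σ₁)) - σ₁ ^ 4 * σ₃ * (X * derivative σ₁) ^ 2 - σ₁ ^ 4 * σ₃ * (X * derivative (X * derivative σ₂)) - 6 * σ₁ ^ 3 * σ₂ * σ₃ * (X * derivative (X * derivative σ₁))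
          + 4 * σ₁ ^ 3 * σ₃ * (X * derivative σ₁) * (X * derivative σ₂) + σ₁ ^ 3 * σ₃ * (X * derivative (X * derivative σ₃)) + 2 * σ₁ ^ 2 * σ₂ * σ₃ * (X * derivative σ₁) ^ 2
          + 5 * σ₁ ^ 2 * σ₂ * σ₃ * (X * derivative (X * derivative σ₂)) + 7 * σ₁ ^ 2 * σ₃ ^ 2 * (X * derivative (X * derivative σ₁)) - 6 * σ₁ ^ 2 * σ₃ * (X * derivative σ₁) * (X * derivative σ₃)
          - 3 * σ₁ ^ 2 * σ₃ * (X * derivative σ₂) ^ 2 + 8 * σ₁ * σ₂ ^ 2 * σ₃ * (X * derivative (X * derivative σ₁)) - 8 * σ₁ * σ₂ * σ₃ * (X * derivative σ₁) * (X * derivative σ₂)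
          - 4 * σ₁ * σ₂ * σ₃ * (X * derivative (X * derivative σ₃)) + 2 * σ₁ * σ₃ ^ 2 * (X * derivative σ₁) ^ 2 - 6 * σ₁ * σ₃ ^ 2 * (X * derivative (X * derivative σ₂))
          + 8 * σ₁ * σ₃ * (X * derivative σ₂) * (X * derivative σ₃) - 4 * σ₂ ^ 2 * σ₃ * (X * derivative (X * derivative σ₂)) - 12 * σ₂ * σ₃ ^ 2 * (X * derivative (X * derivative σ₁))
          + 8 * σ₂ * σ₃ * (X * derivative σ₁) * (X * derivative σ₃) + 4 * σ₂ * σ₃ * (X * derivative σ₂) ^ 2 + 9 * σ₃ ^ 2 * (X * derivative (X * derivative σ₃))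
          - 9 * σ₃ * (X * derivative σ₃) ^ 2)
    (hL1 : L₁ = (σ₂ * R₂ ^ 2 - R₀ * R₂ - σ₁ * R₁ * R₂ + R₁ ^ 2)) (hL0 : L₀ = (σ₃ * R₂ ^ 2 - σ₁ * R₀ * R₂ + R₀ * R₁))
    (hN : (R₂ * L₀ ^ 2 - R₁ * L₀ * L₁ + R₀ * L₁ ^ 2) ≠ 0) (hL : L₁ ≠ 0)
    (NN NL : ℕ) (hNN : (R₂ * L₀ ^ 2 - R₁ * L₀ * L₁ + R₀ * L₁ ^ 2).natDegree ≤ NN) (hNL : L₁.natDegree ≤ NL) :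
    {p : Fin 2 → ℝ | 0 < p 0 ∧ 0 < p 1 ∧ MvPolynomial.eval p (∑ l, (MvPolynomial.X (0 : Fin 2) : MvPolynomial (Fin 2) ℝ) ^ d l • (S l).map (MvPolynomial.C : ℝ →+* MvPolynomial (Fin 2) ℝ) +
      (MvPolynomial.X (1 : Fin 2) : MvPolynomial (Fin 2) ℝ) • (Matrix.fromBlocks 1 0 0 0 : Matrix (Fin 3 ⊕ Fin 0) (Fin 3 ⊕ Fin 0) ℝ).map (MvPolynomial.C : ℝ →+* MvPolynomial (Fin 2) ℝ)).det = 0 ∧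
      MvPolynomial.eval p (MvPolynomial.X 0 * MvPolynomial.pderiv 0 (MvPolynomial.X 0 * MvPolynomial.pderiv 0 (∑ l, (MvPolynomial.X (0 : Fin 2) : MvPolynomial (Fin 2) ℝ) ^ d l • (S l).map
      (MvPolynomial.C : ℝ →+* MvPolynomial (Fin 2) ℝ) + (MvPolynomial.X (1 : Fin 2) : MvPolynomial (Fin 2) ℝ) • (Matrix.fromBlocks 1 0 0 0 : Matrix (Fin 3 ⊕ Fin 0) (Fin 3 ⊕ Fin 0) ℝ).map
      (MvPolynomial.C : ℝ →+* MvPolynomial (Fin 2) ℝ)).det) * (MvPolynomial.X 1 * MvPolynomial.pderiv 1 (∑ l, (MvPolynomial.X (0 : Fin 2) : MvPolynomial (Fin 2) ℝ) ^ d l • (S l).map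
      (MvPolynomial.C : ℝ →+* MvPolynomial (Fin 2) ℝ) + (MvPolynomial.X (1 : Fin 2) : MvPolynomial (Fin 2) ℝ) • (Matrix.fromBlocks 1 0 0 0 : Matrix (Fin 3 ⊕ Fin 0) (Fin 3 ⊕ Fin 0) ℝ).map
      (MvPolynomial.C : ℝ →+* MvPolynomial (Fin 2) ℝ)).det) ^ 2 - 2 * (MvPolynomial.X 0 * MvPolynomial.pderiv 0 (MvPolynomial.X 1 * MvPolynomial.pderiv 1 (∑ l, (MvPolynomial.X (0 : Fin 2) :
      MvPolynomial (Fin 2) ℝ) ^ d l • (S l).map (MvPolynomial.C : ℝ →+* MvPolynomial (Fin 2) ℝ) + (MvPolynomial.X (1 : Fin 2) : MvPolynomial (Fin 2) ℝ) • (Matrix.fromBlocks 1 0 0 0 : Matrix (Fin 3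
      ⊕ Fin 0) (Fin 3 ⊕ Fin 0) ℝ).map (MvPolynomial.C : ℝ →+* MvPolynomial (Fin 2) ℝ)).det)) * (MvPolynomial.X 0 * MvPolynomial.pderiv 0 (∑ l, (MvPolynomial.X (0 : Fin 2) : MvPolynomial (Fin 2) ℝ)
      ^ d l • (S l).map (MvPolynomial.C : ℝ →+* MvPolynomial (Fin 2) ℝ) + (MvPolynomial.X (1 : Fin 2) : MvPolynomial (Fin 2) ℝ) • (Matrix.fromBlocks 1 0 0 0 : Matrix (Fin 3 ⊕ Fin 0) (Fin 3 ⊕ Fin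
      0) ℝ).map (MvPolynomial.C : ℝ →+* MvPolynomial (Fin 2) ℝ)).det) * (MvPolynomial.X 1 * MvPolynomial.pderiv 1 (∑ l, (MvPolynomial.X (0 : Fin 2) : MvPolynomial (Fin 2) ℝ) ^ d l • (S l).map
      (MvPolynomial.C : ℝ →+* MvPolynomial (Fin 2) ℝ) + (MvPolynomial.X (1 : Fin 2) : MvPolynomial (Fin 2) ℝ) • (Matrix.fromBlocks 1 0 0 0 : Matrix (Fin 3 ⊕ Fin 0) (Fin 3 ⊕ Fin 0) ℝ).map
      (MvPolynomial.C : ℝ →+* MvPolynomial (Fin 2) ℝ)).det) + MvPolynomial.X 1 * MvPolynomial.pderiv 1 (MvPolynomial.X 1 * MvPolynomial.pderiv 1 (∑ l, (MvPolynomial.X (0 : Fin 2) : MvPolynomial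
      (Fin 2) ℝ) ^ d l • (S l).map (MvPolynomial.C : ℝ →+* MvPolynomial (Fin 2) ℝ) + (MvPolynomial.X (1 : Fin 2) : MvPolynomial (Fin 2) ℝ) • (Matrix.fromBlocks 1 0 0 0 : Matrix (Fin 3 ⊕ Fin 0)
      (Fin 3 ⊕ Fin 0) ℝ).map (MvPolynomial.C : ℝ →+* MvPolynomial (Fin 2) ℝ)).det) * (MvPolynomial.X 0 * MvPolynomial.pderiv 0 (∑ l, (MvPolynomial.X (0 : Fin 2) : MvPolynomial (Fin 2) ℝ) ^ d l •
      (S l).map (MvPolynomial.C : ℝ →+* MvPolynomial (Fin 2) ℝ) + (MvPolynomial.X (1 : Fin 2) : MvPolynomial (Fin 2) ℝ) • (Matrix.fromBlocks 1 0 0 0 : Matrix (Fin 3 ⊕ Fin 0) (Fin 3 ⊕ Fin 0) ℝ).map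
      (MvPolynomial.C : ℝ →+* MvPolynomial (Fin 2) ℝ)).det) ^ 2) = 0}.Finite ∧
    {p : Fin 2 → ℝ | 0 < p 0 ∧ 0 < p 1 ∧ MvPolynomial.eval p (∑ l, (MvPolynomial.X (0 : Fin 2) : MvPolynomial (Fin 2) ℝ) ^ d l • (S l).map (MvPolynomial.C : ℝ →+* MvPolynomial (Fin 2) ℝ) +
      (MvPolynomial.X (1 : Fin 2) : MvPolynomial (Fin 2) ℝ) • (Matrix.fromBlocks 1 0 0 0 : Matrix (Fin 3 ⊕ Fin 0) (Fin 3 ⊕ Fin 0) ℝ).map (MvPolynomial.C : ℝ →+* MvPolynomial (Fin 2) ℝ)).det = 0 ∧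
      MvPolynomial.eval p (MvPolynomial.X 0 * MvPolynomial.pderiv 0 (MvPolynomial.X 0 * MvPolynomial.pderiv 0 (∑ l, (MvPolynomial.X (0 : Fin 2) : MvPolynomial (Fin 2) ℝ) ^ d l • (S l).map
      (MvPolynomial.C : ℝ →+* MvPolynomial (Fin 2) ℝ) + (MvPolynomial.X (1 : Fin 2) : MvPolynomial (Fin 2) ℝ) • (Matrix.fromBlocks 1 0 0 0 : Matrix (Fin 3 ⊕ Fin 0) (Fin 3 ⊕ Fin 0) ℝ).map
      (MvPolynomial.C : ℝ →+* MvPolynomial (Fin 2) ℝ)).det) * (MvPolynomial.X 1 * MvPolynomial.pderiv 1 (∑ l, (MvPolynomial.X (0 : Fin 2) : MvPolynomial (Fin 2) ℝ) ^ d l • (S l).map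
      (MvPolynomial.C : ℝ →+* MvPolynomial (Fin 2) ℝ) + (MvPolynomial.X (1 : Fin 2) : MvPolynomial (Fin 2) ℝ) • (Matrix.fromBlocks 1 0 0 0 : Matrix (Fin 3 ⊕ Fin 0) (Fin 3 ⊕ Fin 0) ℝ).map
      (MvPolynomial.C : ℝ →+* MvPolynomial (Fin 2) ℝ)).det) ^ 2 - 2 * (MvPolynomial.X 0 * MvPolynomial.pderiv 0 (MvPolynomial.X 1 * MvPolynomial.pderiv 1 (∑ l, (MvPolynomial.X (0 : Fin 2) :
      MvPolynomial (Fin 2) ℝ) ^ d l • (S l).map (MvPolynomial.C : ℝ →+* MvPolynomial (Fin 2) ℝ) + (MvPolynomial.X (1 : Fin 2) : MvPolynomial (Fin 2) ℝ) • (Matrix.fromBlocks 1 0 0 0 : Matrix (Fin 3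
      ⊕ Fin 0) (Fin 3 ⊕ Fin 0) ℝ).map (MvPolynomial.C : ℝ →+* MvPolynomial (Fin 2) ℝ)).det)) * (MvPolynomial.X 0 * MvPolynomial.pderiv 0 (∑ l, (MvPolynomial.X (0 : Fin 2) : MvPolynomial (Fin 2) ℝ)
      ^ d l • (S l).map (MvPolynomial.C : ℝ →+* MvPolynomial (Fin 2) ℝ) + (MvPolynomial.X (1 : Fin 2) : MvPolynomial (Fin 2) ℝ) • (Matrix.fromBlocks 1 0 0 0 : Matrix (Fin 3 ⊕ Fin 0) (Fin 3 ⊕ Fin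
      0) ℝ).map (MvPolynomial.C : ℝ →+* MvPolynomial (Fin 2) ℝ)).det) * (MvPolynomial.X 1 * MvPolynomial.pderiv 1 (∑ l, (MvPolynomial.X (0 : Fin 2) : MvPolynomial (Fin 2) ℝ) ^ d l • (S l).map
      (MvPolynomial.C : ℝ →+* MvPolynomial (Fin 2) ℝ) + (MvPolynomial.X (1 : Fin 2) : MvPolynomial (Fin 2) ℝ) • (Matrix.fromBlocks 1 0 0 0 : Matrix (Fin 3 ⊕ Fin 0) (Fin 3 ⊕ Fin 0) ℝ).map
      (MvPolynomial.C : ℝ →+* MvPolynomial (Fin 2) ℝ)).det) + MvPolynomial.X 1 * MvPolynomial.pderiv 1 (MvPolynomial.X 1 * MvPolynomial.pderiv 1 (∑ l, (MvPolynomial.X (0 : Fin 2) : MvPolynomial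
      (Fin 2) ℝ) ^ d l • (S l).map (MvPolynomial.C : ℝ →+* MvPolynomial (Fin 2) ℝ) + (MvPolynomial.X (1 : Fin 2) : MvPolynomial (Fin 2) ℝ) • (Matrix.fromBlocks 1 0 0 0 : Matrix (Fin 3 ⊕ Fin 0)
      (Fin 3 ⊕ Fin 0) ℝ).map (MvPolynomial.C : ℝ →+* MvPolynomial (Fin 2) ℝ)).det) * (MvPolynomial.X 0 * MvPolynomial.pderiv 0 (∑ l, (MvPolynomial.X (0 : Fin 2) : MvPolynomial (Fin 2) ℝ) ^ d l •
      (S l).map (MvPolynomial.C : ℝ →+* MvPolynomial (Fin 2) ℝ) + (MvPolynomial.X (1 : Fin 2) : MvPolynomial (Fin 2) ℝ) • (Matrix.fromBlocks 1 0 0 0 : Matrix (Fin 3 ⊕ Fin 0) (Fin 3 ⊕ Fin 0) ℝ).map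
      (MvPolynomial.C : ℝ →+* MvPolynomial (Fin 2) ℝ)).det) ^ 2) = 0}.ncard ≤ 3 * (NN + NL) := by
  classical
  have hΦ := OsculationThreeK.insertionPoly_three_zero K d S
  rw [h1, h2, h3] at hΦ
  rw [hΦ]
  set Φ : MvPolynomial (Fin 2) ℝ := (MvPolynomial.X 1 * MvPolynomial.X 1 * MvPolynomial.X 1 + MvPolynomial.X 1 * MvPolynomial.X 1 * Polynomial.aeval (MvPolynomial.X 0 : MvPolynomial (Fin 2) ℝ) σ₁ + MvPolynomial.X 1 * Polynomial.aeval (MvPolynomial.X 0 : MvPolynomial (Fin 2) ℝ) σ₂ + Polynomial.aeval (MvPolynomial.X 0 : MvPolynomial (Fin 2) ℝ) σ₃) with hΦdef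
  set N : ℝ[X] := (R₂ * L₀ ^ 2 - R₁ * L₀ * L₁ + R₀ * L₁ ^ 2) with hNdef
  set osc := {p : Fin 2 → ℝ | 0 < p 0 ∧ 0 < p 1 ∧ MvPolynomial.eval p Φ = 0 ∧
      MvPolynomial.eval p
        (MvPolynomial.X 0 * MvPolynomial.pderiv 0 (MvPolynomial.X 0 * MvPolynomial.pderiv 0 Φ)
            * (MvPolynomial.X 1 * MvPolynomial.pderiv 1 Φ) ^ 2
          - 2 * (MvPolynomial.X 0 * MvPolynomial.pderiv 0 (MvPolynomial.X 1 * MvPolynomial.pderiv 1 Φ))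
            * (MvPolynomial.X 0 * MvPolynomial.pderiv 0 Φ) * (MvPolynomial.X 1 * MvPolynomial.pderiv 1 Φ)
          + MvPolynomial.X 1 * MvPolynomial.pderiv 1 (MvPolynomial.X 1 * MvPolynomial.pderiv 1 Φ)
            * (MvPolynomial.X 0 * MvPolynomial.pderiv 0 Φ) ^ 2) = 0} with hosc
  -- (1) from the set: positivity, the cubic, `L₁(t) b + L₀(t) = 0`, `N(t) = 0`
  have from_osc : ∀ p ∈ osc, 0 < p 0 ∧ 0 < p 1 ∧
      p 1 ^ 3 + p 1 ^ 2 * σ₁.eval (p 0) + p 1 * σ₂.eval (p 0) + σ₃.eval (p 0) = 0 ∧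
      L₁.eval (p 0) * p 1 + L₀.eval (p 0) = 0 ∧ N.eval (p 0) = 0 := by
    intro p hp
    obtain ⟨h0, hp1, hΦ0, hH0⟩ := hp
    rw [hΦdef, OsculationCuspCubic.eval_Phi3] at hΦ0
    rw [OsculationCuspCubic.eval_logHessian_Phi3 σ₁ σ₂ σ₃ Φ hΦdef p] at hH0
    have hQ := (OsculationCuspCubic.hess_reduce_poly3 σ₁ σ₂ σ₃ (p 0) (p 1) hΦ0).1 hH0
    rw [← hR2, ← hR1, ← hR0] at hQ
    have hl := OsculationCuspCubic.linear_step3 hΦ0 hQ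
    have hlo : L₁.eval (p 0) * p 1 + L₀.eval (p 0) = 0 := by
      rw [hL1, hL0]
      simp only [eval_sub, eval_add, eval_mul, eval_pow]
      linear_combination hl
    have hn := OsculationCuspCubic.resultant_step3 (r₂ := R₂.eval (p 0)) (r₁ := R₁.eval (p 0)) (r₀ := R₀.eval (p 0)) hlo
    rw [hQ, mul_zero] at hn
    refine ⟨h0, hp1, hΦ0, hlo, ?_⟩
    rw [hNdef]
    simp only [eval_sub, eval_add, eval_mul, eval_pow]
    linear_combination hn
  -- (2) a finite cover
  set T : Finset ℝ := N.roots.toFinset ∪ L₁.roots.toFinset with hT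
  set F : Finset (Fin 2 → ℝ) := T.biUnion (fun t =>
    ((C (1 : ℝ) * X ^ 3 + C (σ₁.eval t) * X ^ 2 + C (σ₂.eval t) * X + C (σ₃.eval t) : ℝ[X]).roots.toFinset).image
      (fun b => (![t, b] : Fin 2 → ℝ))) with hF
  have hsub : osc ⊆ ↑F := by
    intro p hp
    obtain ⟨ht, hb, hΨ0, hl, hn⟩ := from_osc p hp
    rw [Finset.mem_coe, hF, Finset.mem_biUnion]
    refine ⟨p 0, ?_, ?_⟩
    · rw [hT, Finset.mem_union, Multiset.mem_toFinset, Multiset.mem_toFinset]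
      by_cases hu : L₁.eval (p 0) = 0
      · exact Or.inr ((mem_roots hL).2 hu)
      · exact Or.inl ((mem_roots hN).2 hn)
    · rw [Finset.mem_image]
      refine ⟨p 1, ?_, ?_⟩
      · rw [Multiset.mem_toFinset, mem_roots (monicCubic_ne_zero _ _ _), IsRoot.def]
        simp only [eval_add, eval_mul, eval_pow, eval_C, eval_X]
        linear_combination hΨ0
      · funext i
        fin_cases i
        · rfl
        · rfl
  have hfin : osc.Finite := (Finset.finite_toSet F).subset hsub
  refine ⟨hfin, ?_⟩
  have hTcard : T.card ≤ NN + NL := by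
    rw [hT]
    refine (Finset.card_union_le _ _).trans (Nat.add_le_add ?_ ?_)
    · exact (Multiset.toFinset_card_le _).trans ((card_roots' N).trans hNN)
    · exact (Multiset.toFinset_card_le _).trans ((card_roots' L₁).trans hNL)
  calc osc.ncard ≤ (↑F : Set (Fin 2 → ℝ)).ncard := Set.ncard_le_ncard hsub (Finset.finite_toSet F)
    _ = F.card := Set.ncard_coe_finset F
    _ ≤ ∑ t ∈ T, (((C (1 : ℝ) * X ^ 3 + C (σ₁.eval t) * X ^ 2 + C (σ₂.eval t) * X + C (σ₃.eval t) : ℝ[X]).roots.toFinset).image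
          (fun b => (![t, b] : Fin 2 → ℝ))).card := Finset.card_biUnion_le
    _ ≤ ∑ _t ∈ T, 3 := by
        refine Finset.sum_le_sum fun t _ => ?_
        refine Finset.card_image_le.trans ((Multiset.toFinset_card_le _).trans ?_)
        exact (card_roots' _).trans natDegree_cubic_le
    _ = T.card * 3 := by rw [Finset.sum_const, smul_eq_mul]
    _ ≤ (NN + NL) * 3 := Nat.mul_le_mul_right _ hTcard
    _ = 3 * (NN + NL) := Nat.mul_comm _ _

-- same statement size.
set_option maxHeartbeats 1600000 in
/-- **Rank-three TOP LOWER certificate, splitting `(3, 0)`.**  See the module docstring. [folklore] -/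
theorem osc_rankThreeTop_card_ge {K : ℕ} (d : Fin K → ℕ) (S : Fin K → Matrix (Fin 3 ⊕ Fin 0) (Fin 3 ⊕ Fin 0) ℝ)
    (σ₁ σ₂ σ₃ R₂ R₁ R₀ L₁ L₀ : ℝ[X])
    (h1 : (∑ l, (X : ℝ[X]) ^ d l • (S l).map Polynomial.C) (Sum.inl 0) (Sum.inl 0) + (∑ l, (X : ℝ[X]) ^ d l • (S l).map Polynomial.C) (Sum.inl 1) (Sum.inl 1) + (∑ l, (X : ℝ[X]) ^ d l • (S l).map Polynomial.C) (Sum.inl 2) (Sum.inl 2) = σ₁)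
    (h2 : (∑ l, (X : ℝ[X]) ^ d l • (S l).map Polynomial.C) (Sum.inl 0) (Sum.inl 0) * (∑ l, (X : ℝ[X]) ^ d l • (S l).map Polynomial.C) (Sum.inl 1) (Sum.inl 1) - (∑ l, (X : ℝ[X]) ^ d l • (S l).map Polynomial.C) (Sum.inl 0) (Sum.inl 1) * (∑ l, (X : ℝ[X]) ^ d l • (S l).map Polynomial.C) (Sum.inl 1) (Sum.inl 0) + (∑ l, (X : ℝ[X]) ^ d l • (S l).map Polynomial.C) (Sum.inl 0) (Sum.inl 0) * (∑ l, (X : ℝ[X]) ^ d l • (S l).map Polynomial.C) (Sum.inl 2) (Sum.inl 2) - (∑ l, (X : ℝ[X]) ^ d l • (S l).map Polynomial.C) (Sum.inl 0) (Sum.inl 2) * (∑ l, (X : ℝ[X]) ^ d l • (S l).map Polynomial.C) (Sum.inl 2) (Sum.inl 0) + (∑ l, (X : ℝ[X]) ^ d l • (S l).map Polynomial.C) (Sum.inl 1) (Sum.inl 1) * (∑ l, (X : ℝ[X]) ^ d l • (S l).map Polynomial.C) (Sum.inl 2) (Sum.inl 2) - (∑ l, (X : ℝ[X]) ^ d l •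 (S l).map Polynomial.C) (Sum.inl 1) (Sum.inl 2) * (∑ l, (X : ℝ[X]) ^ d l • (S l).map Polynomial.C) (Sum.inl 2) (Sum.inl 1) = σ₂)
    (h3 : (∑ l, (X : ℝ[X]) ^ d l • (S l).map Polynomial.C) (Sum.inl 0) (Sum.inl 0) * (∑ l, (X : ℝ[X]) ^ d l • (S l).map Polynomial.C) (Sum.inl 1) (Sum.inl 1) * (∑ l, (X : ℝ[X]) ^ d l • (S l).map Polynomial.C) (Sum.inl 2) (Sum.inl 2) - (∑ l, (X : ℝ[X]) ^ d l • (S l).map Polynomial.C) (Sum.inl 0) (Sum.inl 0) * (∑ l, (X : ℝ[X]) ^ d l • (S l).map Polynomial.C) (Sum.inl 1) (Sum.inl 2) * (∑ l, (X : ℝ[X]) ^ d l • (S l).map Polynomial.C) (Sum.inl 2) (Sum.inl 1) - (∑ l, (X : ℝ[X]) ^ d l • (S l).map Polynomial.C) (Sum.inl 0) (Sum.inl 1) * (∑ l, (X : ℝ[X]) ^ d l • (S l).map Polynomial.C) (Sum.inl 1) (Sum.inl 0) * (∑ l, (X : ℝ[X]) ^ d l • (S l).map Polynomial.C) (Sum.inl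 2) (Sum.inl 2) + (∑ l, (X : ℝ[X]) ^ d l • (S l).map Polynomial.C) (Sum.inl 0) (Sum.inl 1) * (∑ l, (X : ℝ[X]) ^ d l • (S l).map Polynomial.C) (Sum.inl 1) (Sum.inl 2) * (∑ l, (X : ℝ[X]) ^ d l • (S l).map Polynomial.C) (Sum.inl 2) (Sum.inl 0) + (∑ l, (X : ℝ[X]) ^ d l • (S l).map Polynomial.C) (Sum.inl 0) (Sum.inl 2) * (∑ l, (X : ℝ[X]) ^ d l • (S l).map Polynomial.C) (Sum.inl 1) (Sum.inl 0) * (∑ l, (X : ℝ[X]) ^ d l • (S l).map Polynomial.C) (Sum.inl 2) (Sum.inl 1) - (∑ l, (X : ℝ[X]) ^ d l • (S l).map Polynomial.C) (Sum.inl 0) (Sum.inl 2) * (∑ l, (X : ℝ[X]) ^ d l • (S l).map Polynomial.C) (Sum.inl 1) (Sum.inl 1) * (∑ l, (X : ℝ[X]) ^ d l • (S l).map Polynomial.C) (Sum.inl 2) (Sum.inl 0) = σ₃)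
    (hR2 : R₂ = σ₁ ^ 6 * (X * derivative (X * derivative σ₁)) - σ₁ ^ 5 * (X * derivative σ₁) ^ 2 - σ₁ ^ 5 * (X * derivative (X * derivative σ₂)) - 7 * σ₁ ^ 4 * σ₂ * (X * derivative (X * derivative σ₁))
          + 4 * σ₁ ^ 4 * (X * derivative σ₁) * (X * derivative σ₂) + σ₁ ^ 4 * (X * derivative (X * derivative σ₃)) + 3 * σ₁ ^ 3 * σ₂ * (X * derivative σ₁) ^ 2
          + 6 * σ₁ ^ 3 * σ₂ * (X * derivative (X * derivative σ₂)) + 8 * σ₁ ^ 3 * σ₃ * (X * derivative (X * derivative σ₁)) - 6 * σ₁ ^ 3 * (X * derivative σ₁) * (X * derivative σ₃)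
          - 3 * σ₁ ^ 3 * (X * derivative σ₂) ^ 2 + 13 * σ₁ ^ 2 * σ₂ ^ 2 * (X * derivative (X * derivative σ₁)) - 12 * σ₁ ^ 2 * σ₂ * (X * derivative σ₁) * (X * derivative σ₂)
          - 5 * σ₁ ^ 2 * σ₂ * (X * derivative (X * derivative σ₃)) + σ₁ ^ 2 * σ₃ * (X * derivative σ₁) ^ 2 - 7 * σ₁ ^ 2 * σ₃ * (X * derivative (X * derivative σ₂))
          + 8 * σ₁ ^ 2 * (X * derivative σ₂) * (X * derivative σ₃) - σ₁ * σ₂ ^ 2 * (X * derivative σ₁) ^ 2 - 8 * σ₁ * σ₂ ^ 2 * (X * derivative (X * derivative σ₂))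
          - 22 * σ₁ * σ₂ * σ₃ * (X * derivative (X * derivative σ₁)) + 14 * σ₁ * σ₂ * (X * derivative σ₁) * (X * derivative σ₃) + 7 * σ₁ * σ₂ * (X * derivative σ₂) ^ 2
          + 4 * σ₁ * σ₃ * (X * derivative σ₁) * (X * derivative σ₂) + 6 * σ₁ * σ₃ * (X * derivative (X * derivative σ₃)) - 5 * σ₁ * (X * derivative σ₃) ^ 2
          - 4 * σ₂ ^ 3 * (X * derivative (X * derivative σ₁)) + 4 * σ₂ ^ 2 * (X * derivative σ₁) * (X * derivative σ₂) + 4 * σ₂ ^ 2 * (X * derivative (X * derivative σ₃))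
          - 3 * σ₂ * σ₃ * (X * derivative σ₁) ^ 2 + 12 * σ₂ * σ₃ * (X * derivative (X * derivative σ₂)) - 12 * σ₂ * (X * derivative σ₂) * (X * derivative σ₃)
          + 9 * σ₃ ^ 2 * (X * derivative (X * derivative σ₁)) - 6 * σ₃ * (X * derivative σ₁) * (X * derivative σ₃) - 3 * σ₃ * (X * derivative σ₂) ^ 2)
    (hR1 : R₁ = σ₁ ^ 5 * σ₂ * (X * derivative (X * derivative σ₁)) - σ₁ ^ 4 * σ₂ * (X * derivative σ₁) ^ 2 - σ₁ ^ 4 * σ₂ * (X * derivative (X * derivative σ₂)) - σ₁ ^ 4 * σ₃ * (X * derivative (X * derivative σ₁))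
          - 6 * σ₁ ^ 3 * σ₂ ^ 2 * (X * derivative (X * derivative σ₁)) + 4 * σ₁ ^ 3 * σ₂ * (X * derivative σ₁) * (X * derivative σ₂) + σ₁ ^ 3 * σ₂ * (X * derivative (X * derivative σ₃))
          + σ₁ ^ 3 * σ₃ * (X * derivative σ₁) ^ 2 + σ₁ ^ 3 * σ₃ * (X * derivative (X * derivative σ₂)) + 2 * σ₁ ^ 2 * σ₂ ^ 2 * (X * derivative σ₁) ^ 2
          + 5 * σ₁ ^ 2 * σ₂ ^ 2 * (X * derivative (X * derivative σ₂)) + 12 * σ₁ ^ 2 * σ₂ * σ₃ * (X * derivative (X * derivative σ₁)) - 6 * σ₁ ^ 2 * σ₂ * (X * derivative σ₁) * (X * derivative σ₃)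
          - 3 * σ₁ ^ 2 * σ₂ * (X * derivative σ₂) ^ 2 - 4 * σ₁ ^ 2 * σ₃ * (X * derivative σ₁) * (X * derivative σ₂) - σ₁ ^ 2 * σ₃ * (X * derivative (X * derivative σ₃))
          + 8 * σ₁ * σ₂ ^ 3 * (X * derivative (X * derivative σ₁)) - 8 * σ₁ * σ₂ ^ 2 * (X * derivative σ₁) * (X * derivative σ₂) - 4 * σ₁ * σ₂ ^ 2 * (X * derivative (X * derivative σ₃))
          + σ₁ * σ₂ * σ₃ * (X * derivative σ₁) ^ 2 - 10 * σ₁ * σ₂ * σ₃ * (X * derivative (X * derivative σ₂)) + 8 * σ₁ * σ₂ * (X * derivative σ₂) * (X * derivative σ₃)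
          - 6 * σ₁ * σ₃ ^ 2 * (X * derivative (X * derivative σ₁)) + 6 * σ₁ * σ₃ * (X * derivative σ₁) * (X * derivative σ₃) + 3 * σ₁ * σ₃ * (X * derivative σ₂) ^ 2
          - 4 * σ₂ ^ 3 * (X * derivative (X * derivative σ₂)) - 16 * σ₂ ^ 2 * σ₃ * (X * derivative (X * derivative σ₁)) + 8 * σ₂ ^ 2 * (X * derivative σ₁) * (X * derivative σ₃)
          + 4 * σ₂ ^ 2 * (X * derivative σ₂) ^ 2 + 4 * σ₂ * σ₃ * (X * derivative σ₁) * (X * derivative σ₂) + 12 * σ₂ * σ₃ * (X * derivative (X * derivative σ₃))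
          - 8 * σ₂ * (X * derivative σ₃) ^ 2 - 3 * σ₃ ^ 2 * (X * derivative σ₁) ^ 2 + 9 * σ₃ ^ 2 * (X * derivative (X * derivative σ₂)) - 12 * σ₃ * (X * derivative σ₂) * (X * derivative σ₃))
    (hR0 : R₀ = σ₁ ^ 5 * σ₃ * (X * derivative (X * derivative σ₁)) - σ₁ ^ 4 * σ₃ * (X * derivative σ₁) ^ 2 - σ₁ ^ 4 * σ₃ * (X * derivative (X * derivative σ₂)) - 6 * σ₁ ^ 3 * σ₂ * σ₃ * (X * derivative (X * derivative σ₁))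
          + 4 * σ₁ ^ 3 * σ₃ * (X * derivative σ₁) * (X * derivative σ₂) + σ₁ ^ 3 * σ₃ * (X * derivative (X * derivative σ₃)) + 2 * σ₁ ^ 2 * σ₂ * σ₃ * (X * derivative σ₁) ^ 2
          + 5 * σ₁ ^ 2 * σ₂ * σ₃ * (X * derivative (X * derivative σ₂)) + 7 * σ₁ ^ 2 * σ₃ ^ 2 * (X * derivative (X * derivative σ₁)) - 6 * σ₁ ^ 2 * σ₃ * (X * derivative σ₁) * (X * derivative σ₃)
          - 3 * σ₁ ^ 2 * σ₃ * (X * derivative σ₂) ^ 2 + 8 * σ₁ * σ₂ ^ 2 * σ₃ * (X * derivative (X * derivative σ₁)) - 8 * σ₁ * σ₂ * σ₃ * (X * derivative σ₁) * (X * derivative σ₂)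
          - 4 * σ₁ * σ₂ * σ₃ * (X * derivative (X * derivative σ₃)) + 2 * σ₁ * σ₃ ^ 2 * (X * derivative σ₁) ^ 2 - 6 * σ₁ * σ₃ ^ 2 * (X * derivative (X * derivative σ₂))
          + 8 * σ₁ * σ₃ * (X * derivative σ₂) * (X * derivative σ₃) - 4 * σ₂ ^ 2 * σ₃ * (X * derivative (X * derivative σ₂)) - 12 * σ₂ * σ₃ ^ 2 * (X * derivative (X * derivative σ₁))
          + 8 * σ₂ * σ₃ * (X * derivative σ₁) * (X * derivative σ₃) + 4 * σ₂ * σ₃ * (X * derivative σ₂) ^ 2 + 9 * σ₃ ^ 2 * (X * derivative (X * derivative σ₃))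
          - 9 * σ₃ * (X * derivative σ₃) ^ 2)
    (hL1 : L₁ = (σ₂ * R₂ ^ 2 - R₀ * R₂ - σ₁ * R₁ * R₂ + R₁ ^ 2)) (hL0 : L₀ = (σ₃ * R₂ ^ 2 - σ₁ * R₀ * R₂ + R₀ * R₁))
    (hfin : {p : Fin 2 → ℝ | 0 < p 0 ∧ 0 < p 1 ∧ MvPolynomial.eval p (∑ l, (MvPolynomial.X (0 : Fin 2) : MvPolynomial (Fin 2) ℝ) ^ d l • (S l).map (MvPolynomial.C : ℝ →+* MvPolynomial (Fin 2) ℝ) +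
      (MvPolynomial.X (1 : Fin 2) : MvPolynomial (Fin 2) ℝ) • (Matrix.fromBlocks 1 0 0 0 : Matrix (Fin 3 ⊕ Fin 0) (Fin 3 ⊕ Fin 0) ℝ).map (MvPolynomial.C : ℝ →+* MvPolynomial (Fin 2) ℝ)).det = 0 ∧
      MvPolynomial.eval p (MvPolynomial.X 0 * MvPolynomial.pderiv 0 (MvPolynomial.X 0 * MvPolynomial.pderiv 0 (∑ l, (MvPolynomial.X (0 : Fin 2) : MvPolynomial (Fin 2) ℝ) ^ d l • (S l).map
      (MvPolynomial.C : ℝ →+* MvPolynomial (Fin 2) ℝ) + (MvPolynomial.X (1 : Fin 2) : MvPolynomial (Fin 2) ℝ) • (Matrix.fromBlocks 1 0 0 0 : Matrix (Fin 3 ⊕ Fin 0) (Fin 3 ⊕ Fin 0) ℝ).map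
      (MvPolynomial.C : ℝ →+* MvPolynomial (Fin 2) ℝ)).det) * (MvPolynomial.X 1 * MvPolynomial.pderiv 1 (∑ l, (MvPolynomial.X (0 : Fin 2) : MvPolynomial (Fin 2) ℝ) ^ d l • (S l).map
      (MvPolynomial.C : ℝ →+* MvPolynomial (Fin 2) ℝ) + (MvPolynomial.X (1 : Fin 2) : MvPolynomial (Fin 2) ℝ) • (Matrix.fromBlocks 1 0 0 0 : Matrix (Fin 3 ⊕ Fin 0) (Fin 3 ⊕ Fin 0) ℝ).map
      (MvPolynomial.C : ℝ →+* MvPolynomial (Fin 2) ℝ)).det) ^ 2 - 2 * (MvPolynomial.X 0 * MvPolynomial.pderiv 0 (MvPolynomial.X 1 * MvPolynomial.pderiv 1 (∑ l, (MvPolynomial.X (0 : Fin 2) :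
      MvPolynomial (Fin 2) ℝ) ^ d l • (S l).map (MvPolynomial.C : ℝ →+* MvPolynomial (Fin 2) ℝ) + (MvPolynomial.X (1 : Fin 2) : MvPolynomial (Fin 2) ℝ) • (Matrix.fromBlocks 1 0 0 0 : Matrix (Fin 3
      ⊕ Fin 0) (Fin 3 ⊕ Fin 0) ℝ).map (MvPolynomial.C : ℝ →+* MvPolynomial (Fin 2) ℝ)).det)) * (MvPolynomial.X 0 * MvPolynomial.pderiv 0 (∑ l, (MvPolynomial.X (0 : Fin 2) : MvPolynomial (Fin 2) ℝ)
      ^ d l • (S l).map (MvPolynomial.C : ℝ →+* MvPolynomial (Fin 2) ℝ) + (MvPolynomial.X (1 : Fin 2) : MvPolynomial (Fin 2) ℝ) • (Matrix.fromBlocks 1 0 0 0 : Matrix (Fin 3 ⊕ Fin 0) (Fin 3 ⊕ Fin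
      0) ℝ).map (MvPolynomial.C : ℝ →+* MvPolynomial (Fin 2) ℝ)).det) * (MvPolynomial.X 1 * MvPolynomial.pderiv 1 (∑ l, (MvPolynomial.X (0 : Fin 2) : MvPolynomial (Fin 2) ℝ) ^ d l • (S l).map
      (MvPolynomial.C : ℝ →+* MvPolynomial (Fin 2) ℝ) + (MvPolynomial.X (1 : Fin 2) : MvPolynomial (Fin 2) ℝ) • (Matrix.fromBlocks 1 0 0 0 : Matrix (Fin 3 ⊕ Fin 0) (Fin 3 ⊕ Fin 0) ℝ).map
      (MvPolynomial.C : ℝ →+* MvPolynomial (Fin 2) ℝ)).det) + MvPolynomial.X 1 * MvPolynomial.pderiv 1 (MvPolynomial.X 1 * MvPolynomial.pderiv 1 (∑ l, (MvPolynomial.X (0 : Fin 2) : MvPolynomial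
      (Fin 2) ℝ) ^ d l • (S l).map (MvPolynomial.C : ℝ →+* MvPolynomial (Fin 2) ℝ) + (MvPolynomial.X (1 : Fin 2) : MvPolynomial (Fin 2) ℝ) • (Matrix.fromBlocks 1 0 0 0 : Matrix (Fin 3 ⊕ Fin 0)
      (Fin 3 ⊕ Fin 0) ℝ).map (MvPolynomial.C : ℝ →+* MvPolynomial (Fin 2) ℝ)).det) * (MvPolynomial.X 0 * MvPolynomial.pderiv 0 (∑ l, (MvPolynomial.X (0 : Fin 2) : MvPolynomial (Fin 2) ℝ) ^ d l •
      (S l).map (MvPolynomial.C : ℝ →+* MvPolynomial (Fin 2) ℝ) + (MvPolynomial.X (1 : Fin 2) : MvPolynomial (Fin 2) ℝ) • (Matrix.fromBlocks 1 0 0 0 : Matrix (Fin 3 ⊕ Fin 0) (Fin 3 ⊕ Fin 0) ℝ).map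
      (MvPolynomial.C : ℝ →+* MvPolynomial (Fin 2) ℝ)).det) ^ 2) = 0}.Finite)
    (W : List (ℝ × ℝ)) (hsep : W.Pairwise (fun v w => v.2 < w.1))
    (hW : ∀ w ∈ W, 0 < w.1 ∧ w.1 ≤ w.2 ∧
      (∀ x, w.1 ≤ x → x ≤ w.2 → L₁.eval x * L₀.eval x < 0 ∧ R₂.eval x ≠ 0) ∧
      (R₂ * L₀ ^ 2 - R₁ * L₀ * L₁ + R₀ * L₁ ^ 2).eval w.1 * (R₂ * L₀ ^ 2 - R₁ * L₀ * L₁ + R₀ * L₁ ^ 2).eval w.2 ≤ 0) :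
    W.length ≤ {p : Fin 2 → ℝ | 0 < p 0 ∧ 0 < p 1 ∧ MvPolynomial.eval p (∑ l, (MvPolynomial.X (0 : Fin 2) : MvPolynomial (Fin 2) ℝ) ^ d l • (S l).map (MvPolynomial.C : ℝ →+* MvPolynomial (Fin 2) ℝ) +
      (MvPolynomial.X (1 : Fin 2) : MvPolynomial (Fin 2) ℝ) • (Matrix.fromBlocks 1 0 0 0 : Matrix (Fin 3 ⊕ Fin 0) (Fin 3 ⊕ Fin 0) ℝ).map (MvPolynomial.C : ℝ →+* MvPolynomial (Fin 2) ℝ)).det = 0 ∧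
      MvPolynomial.eval p (MvPolynomial.X 0 * MvPolynomial.pderiv 0 (MvPolynomial.X 0 * MvPolynomial.pderiv 0 (∑ l, (MvPolynomial.X (0 : Fin 2) : MvPolynomial (Fin 2) ℝ) ^ d l • (S l).map
      (MvPolynomial.C : ℝ →+* MvPolynomial (Fin 2) ℝ) + (MvPolynomial.X (1 : Fin 2) : MvPolynomial (Fin 2) ℝ) • (Matrix.fromBlocks 1 0 0 0 : Matrix (Fin 3 ⊕ Fin 0) (Fin 3 ⊕ Fin 0) ℝ).map
      (MvPolynomial.C : ℝ →+* MvPolynomial (Fin 2) ℝ)).det) * (MvPolynomial.X 1 * MvPolynomial.pderiv 1 (∑ l, (MvPolynomial.X (0 : Fin 2) : MvPolynomial (Fin 2) ℝ) ^ d l • (S l).map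
      (MvPolynomial.C : ℝ →+* MvPolynomial (Fin 2) ℝ) + (MvPolynomial.X (1 : Fin 2) : MvPolynomial (Fin 2) ℝ) • (Matrix.fromBlocks 1 0 0 0 : Matrix (Fin 3 ⊕ Fin 0) (Fin 3 ⊕ Fin 0) ℝ).map
      (MvPolynomial.C : ℝ →+* MvPolynomial (Fin 2) ℝ)).det) ^ 2 - 2 * (MvPolynomial.X 0 * MvPolynomial.pderiv 0 (MvPolynomial.X 1 * MvPolynomial.pderiv 1 (∑ l, (MvPolynomial.X (0 : Fin 2) :
      MvPolynomial (Fin 2) ℝ) ^ d l • (S l).map (MvPolynomial.C : ℝ →+* MvPolynomial (Fin 2) ℝ) + (MvPolynomial.X (1 : Fin 2) : MvPolynomial (Fin 2) ℝ) • (Matrix.fromBlocks 1 0 0 0 : Matrix (Fin 3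
      ⊕ Fin 0) (Fin 3 ⊕ Fin 0) ℝ).map (MvPolynomial.C : ℝ →+* MvPolynomial (Fin 2) ℝ)).det)) * (MvPolynomial.X 0 * MvPolynomial.pderiv 0 (∑ l, (MvPolynomial.X (0 : Fin 2) : MvPolynomial (Fin 2) ℝ)
      ^ d l • (S l).map (MvPolynomial.C : ℝ →+* MvPolynomial (Fin 2) ℝ) + (MvPolynomial.X (1 : Fin 2) : MvPolynomial (Fin 2) ℝ) • (Matrix.fromBlocks 1 0 0 0 : Matrix (Fin 3 ⊕ Fin 0) (Fin 3 ⊕ Fin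
      0) ℝ).map (MvPolynomial.C : ℝ →+* MvPolynomial (Fin 2) ℝ)).det) * (MvPolynomial.X 1 * MvPolynomial.pderiv 1 (∑ l, (MvPolynomial.X (0 : Fin 2) : MvPolynomial (Fin 2) ℝ) ^ d l • (S l).map
      (MvPolynomial.C : ℝ →+* MvPolynomial (Fin 2) ℝ) + (MvPolynomial.X (1 : Fin 2) : MvPolynomial (Fin 2) ℝ) • (Matrix.fromBlocks 1 0 0 0 : Matrix (Fin 3 ⊕ Fin 0) (Fin 3 ⊕ Fin 0) ℝ).map
      (MvPolynomial.C : ℝ →+* MvPolynomial (Fin 2) ℝ)).det) + MvPolynomial.X 1 * MvPolynomial.pderiv 1 (MvPolynomial.X 1 * MvPolynomial.pderiv 1 (∑ l, (MvPolynomial.X (0 : Fin 2) : MvPolynomial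
      (Fin 2) ℝ) ^ d l • (S l).map (MvPolynomial.C : ℝ →+* MvPolynomial (Fin 2) ℝ) + (MvPolynomial.X (1 : Fin 2) : MvPolynomial (Fin 2) ℝ) • (Matrix.fromBlocks 1 0 0 0 : Matrix (Fin 3 ⊕ Fin 0)
      (Fin 3 ⊕ Fin 0) ℝ).map (MvPolynomial.C : ℝ →+* MvPolynomial (Fin 2) ℝ)).det) * (MvPolynomial.X 0 * MvPolynomial.pderiv 0 (∑ l, (MvPolynomial.X (0 : Fin 2) : MvPolynomial (Fin 2) ℝ) ^ d l •
      (S l).map (MvPolynomial.C : ℝ →+* MvPolynomial (Fin 2) ℝ) + (MvPolynomial.X (1 : Fin 2) : MvPolynomial (Fin 2) ℝ) • (Matrix.fromBlocks 1 0 0 0 : Matrix (Fin 3 ⊕ Fin 0) (Fin 3 ⊕ Fin 0) ℝ).map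
      (MvPolynomial.C : ℝ →+* MvPolynomial (Fin 2) ℝ)).det) ^ 2) = 0}.ncard := by
  classical
  have hΦ := OsculationThreeK.insertionPoly_three_zero K d S
  rw [h1, h2, h3] at hΦ
  rw [hΦ] at hfin ⊢
  set Φ : MvPolynomial (Fin 2) ℝ := (MvPolynomial.X 1 * MvPolynomial.X 1 * MvPolynomial.X 1 + MvPolynomial.X 1 * MvPolynomial.X 1 * Polynomial.aeval (MvPolynomial.X 0 : MvPolynomial (Fin 2) ℝ) σ₁ + MvPolynomial.X 1 * Polynomial.aeval (MvPolynomial.X 0 : MvPolynomial (Fin 2) ℝ) σ₂ + Polynomial.aeval (MvPolynomial.X 0 : MvPolynomial (Fin 2) ℝ) σ₃) with hΦdef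
  set N : ℝ[X] := (R₂ * L₀ ^ 2 - R₁ * L₀ * L₁ + R₀ * L₁ ^ 2) with hNdef
  set osc := {p : Fin 2 → ℝ | 0 < p 0 ∧ 0 < p 1 ∧ MvPolynomial.eval p Φ = 0 ∧
      MvPolynomial.eval p
        (MvPolynomial.X 0 * MvPolynomial.pderiv 0 (MvPolynomial.X 0 * MvPolynomial.pderiv 0 Φ)
            * (MvPolynomial.X 1 * MvPolynomial.pderiv 1 Φ) ^ 2
          - 2 * (MvPolynomial.X 0 * MvPolynomial.pderiv 0 (MvPolynomial.X 1 * MvPolynomial.pderiv 1 Φ))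
            * (MvPolynomial.X 0 * MvPolynomial.pderiv 0 Φ) * (MvPolynomial.X 1 * MvPolynomial.pderiv 1 Φ)
          + MvPolynomial.X 1 * MvPolynomial.pderiv 1 (MvPolynomial.X 1 * MvPolynomial.pderiv 1 Φ)
            * (MvPolynomial.X 0 * MvPolynomial.pderiv 0 Φ) ^ 2) = 0} with hosc
  -- from real numbers to the set (over `R₂ ≠ 0`, `L₁ ≠ 0`)
  have mem_of : ∀ p : Fin 2 → ℝ, 0 < p 0 → 0 < p 1 → R₂.eval (p 0) ≠ 0 → L₁.eval (p 0) ≠ 0 →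
      L₁.eval (p 0) * p 1 + L₀.eval (p 0) = 0 → N.eval (p 0) = 0 → p ∈ osc := by
    intro p h0 hp1 hR hLt hl hn
    -- the Hessian quadratic vanishes: `N = L₁² · Q`
    have hres := OsculationCuspCubic.resultant_step3 (r₂ := R₂.eval (p 0)) (r₁ := R₁.eval (p 0)) (r₀ := R₀.eval (p 0)) hl
    have hNv : R₂.eval (p 0) * L₀.eval (p 0) ^ 2 - R₁.eval (p 0) * L₀.eval (p 0) * L₁.eval (p 0) + R₀.eval (p 0) * L₁.eval (p 0) ^ 2 = 0 := by
      rw [hNdef] at hn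
      simpa only [eval_sub, eval_add, eval_mul, eval_pow] using hn
    have hQ : R₂.eval (p 0) * p 1 ^ 2 + R₁.eval (p 0) * p 1 + R₀.eval (p 0) = 0 := by
      rw [hNv] at hres
      exact (mul_eq_zero.1 hres.symm).resolve_left (pow_ne_zero 2 hLt)
    -- the linear form in the tree's expanded shape
    have hl' : ((σ₂.eval (p 0)) * (R₂.eval (p 0)) ^ 2 - (R₀.eval (p 0)) * (R₂.eval (p 0)) - (σ₁.eval (p 0)) * (R₁.eval (p 0)) * (R₂.eval (p 0))
        + (R₁.eval (p 0)) ^ 2) * p 1 + ((σ₃.eval (p 0)) * (R₂.eval (p 0)) ^ 2 - (σ₁.eval (p 0)) * (R₀.eval (p 0)) * (R₂.eval (p 0))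
        + (R₀.eval (p 0)) * (R₁.eval (p 0))) = 0 := by
      have := hl
      rw [hL1, hL0] at this
      simpa only [eval_sub, eval_add, eval_mul, eval_pow] using this
    -- the cubic vanishes: `R₂² Φ = q·Q + (L₁ b + L₀)`
    have hΨ0 : p 1 ^ 3 + p 1 ^ 2 * σ₁.eval (p 0) + p 1 * σ₂.eval (p 0) + σ₃.eval (p 0) = 0 := by
      have he := OsculationCuspCubic.euclid_step3 (p 1) (σ₁.eval (p 0)) (σ₂.eval (p 0)) (σ₃.eval (p 0)) (R₂.eval (p 0)) (R₁.eval (p 0)) (R₀.eval (p 0))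
      rw [hQ, mul_zero, zero_add, hl'] at he
      exact (mul_eq_zero.1 he).resolve_left (pow_ne_zero 2 hR)
    refine ⟨h0, hp1, ?_, ?_⟩
    · rw [hΦdef, OsculationCuspCubic.eval_Phi3]; exact hΨ0
    · rw [OsculationCuspCubic.eval_logHessian_Phi3 σ₁ σ₂ σ₃ Φ hΦdef p]
      have hiff := OsculationCuspCubic.hess_reduce_poly3 σ₁ σ₂ σ₃ (p 0) (p 1) hΨ0
      rw [← hR2, ← hR1, ← hR0] at hiff
      exact hiff.2 hQ
  -- index the windows
  set k := W.length with hk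
  set l : Fin k → ℝ := fun i => (W.get i).1 with hl
  set u : Fin k → ℝ := fun i => (W.get i).2 with hu
  have hWi : ∀ i : Fin k, 0 < l i ∧ l i ≤ u i ∧
      (∀ x, l i ≤ x → x ≤ u i → L₁.eval x * L₀.eval x < 0 ∧ R₂.eval x ≠ 0) ∧
      N.eval (l i) * N.eval (u i) ≤ 0 := fun i => by
    simpa [hl, hu, hNdef] using hW (W.get i) (List.get_mem W i)
  have hsep' : ∀ i j : Fin k, i < j → u i < l j := by
    intro i j hij
    have := List.pairwise_iff_get.1 hsep i j hij
    simpa [hl, hu] using this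
  have hroot : ∀ i, ∃ t, l i ≤ t ∧ t ≤ u i ∧ N.eval t = 0 := fun i =>
    exists_root_of_mul_nonpos N (hWi i).2.1 (hWi i).2.2.2
  choose t ht using hroot
  set pt : Fin k → (Fin 2 → ℝ) := fun i => ![t i, -L₀.eval (t i) / L₁.eval (t i)] with hpt
  have hmem : ∀ i, pt i ∈ osc := by
    intro i
    obtain ⟨htl, htu, hNt⟩ := ht i
    obtain ⟨hs, hR⟩ := (hWi i).2.2.1 (t i) htl htu
    have hLt : L₁.eval (t i) ≠ 0 := fun h => by rw [h, zero_mul] at hs; exact lt_irrefl _ hs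
    have ht0 : 0 < t i := lt_of_lt_of_le (hWi i).1 htl
    have hb : 0 < -L₀.eval (t i) / L₁.eval (t i) := by
      have hL2 : 0 < L₁.eval (t i) ^ 2 := by positivity
      have : -L₀.eval (t i) / L₁.eval (t i) = -(L₁.eval (t i) * L₀.eval (t i)) / L₁.eval (t i) ^ 2 := by
        field_simp
      rw [this]
      exact div_pos (by linarith) hL2
    have hline : L₁.eval (t i) * (-L₀.eval (t i) / L₁.eval (t i)) + L₀.eval (t i) = 0 := by
      field_simp
      ring
    refine mem_of (pt i) ?_ ?_ ?_ ?_ ?_ ?_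
    · simpa [hpt] using ht0
    · simpa [hpt] using hb
    · simpa [hpt] using hR
    · simpa [hpt] using hLt
    · simpa [hpt] using hline
    · simpa [hpt] using hNt
  have hinj : Function.Injective pt := by
    intro i j hij
    have h0 : t i = t j := by
      have := congr_fun hij 0
      simpa [hpt] using this
    by_contra hne
    rcases lt_or_gt_of_ne hne with h | h
    · have := hsep' i j h
      linarith [(ht i).2.1, (ht j).1]
    · have := hsep' j i h
      linarith [(ht j).2.1, (ht i).1]
  have hsub : ↑(Finset.univ.image pt) ⊆ osc := by
    intro p hp
    rw [Finset.mem_coe, Finset.mem_image] at hp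
    obtain ⟨i, -, rfl⟩ := hp
    exact hmem i
  calc k = (Finset.univ.image pt).card := by rw [Finset.card_image_of_injective _ hinj, Finset.card_univ, Fintype.card_fin]
    _ = (↑(Finset.univ.image pt) : Set (Fin 2 → ℝ)).ncard := (Set.ncard_coe_finset _).symm
    _ ≤ osc.ncard := Set.ncard_le_ncard hsub hfin

end OsculationCensus

end Summit.ValiantsHypothesis.ValiantsHypothesis.Theorems.LacunarySymmetroidMatrixDescartes
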